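import Summits.Langlands.Langlands.Theorems.RationalPeriodQuarterAnalyticCoreCoord

/-!
# `AnalyticCore` (child 2 of the lens-1-g38 split of `RationalPeriodQuarter.SemiAnalyticRigidity`) — the periodic step

A function `k` that is tame at every real point, `1`-periodic off a finite set, and in the coordinate
`u = (N t + 1)⁻¹` at infinity of the form `k (τ u) = u·G u + w u` (`u > 0` small) and `k (τ u) = -u·G u - w u`
(`u < 0` small) with `G` analytic at `0` and `w = Pw/Qw` a reduced fraction, vanishes off a finite set:
on the dense `ℤ`-stable set `D` of points whose whole `ℤ`-orbit avoids the exceptional set, `k` is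
`ℤ`-periodic, so along `t + n → +∞` one reads `Qw 0 ≠ 0` and `k = w 0` on `D`, along `t - n → -∞` one reads
`k = -w 0` on `D`; hence `k = 0` on `D`, and continuity on the punctured charts upgrades this to every
punctured neighbourhood and both tails.
-/

set_option linter.dupNamespace false

namespace Summit.Langlands.Langlands.Theorems

open Filter Set Topology Polynomial

/-- A function continuous at every point of an open set and vanishing on a dense subset of it vanishes on it. -/
theorem anCore_zero_of_dense (ψ : ℝ → ℂ) (U D : Set ℝ) (hU : IsOpen U) (hD : Dense D)
    (hψ : ∀ y ∈ U, ContinuousAt ψ y) (h0 : ∀ t ∈ U ∩ D, ψ t = 0) : ∀ y ∈ U, ψ y = 0 := by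
  intro y hy
  have hcl : y ∈ closure (U ∩ D) := hD.open_subset_closure_inter hU hy
  haveI hne : (𝓝[U ∩ D] y).NeBot := mem_closure_iff_nhdsWithin_neBot.1 hcl
  have h1 : Tendsto ψ (𝓝[U ∩ D] y) (𝓝 (ψ y)) := (hψ y hy).continuousWithinAt.tendsto
  have h2 : Tendsto ψ (𝓝[U ∩ D] y) (𝓝 0) := by
    apply tendsto_const_nhds.congr'
    filter_upwards [self_mem_nhdsWithin] with t ht using (h0 t ht).symm
  exact tendsto_nhds_unique h1 h2

/-- THE PERIODIC STEP (see the module docstring). -/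
theorem anCore_zero (N : ℕ) (hN : 0 < N) (k G : ℝ → ℂ) (hG : AnalyticAt ℝ G 0) (Pw Qw : ℂ[X])
    (hco : ∀ β : ℂ, ¬ (Pw.IsRoot β ∧ Qw.IsRoot β)) (δ : ℝ) (hδ : 0 < δ)
    (hR : ∀ u : ℝ, 0 < u → u < δ → Qw.eval (u : ℂ) ≠ 0 ∧
      k ((1 - u) / ((N : ℝ) * u)) = (u : ℂ) * G u + Pw.eval (u : ℂ) / Qw.eval (u : ℂ))
    (hL : ∀ u : ℝ, u < 0 → -δ < u → Qw.eval (u : ℂ) ≠ 0 ∧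
      k ((1 - u) / ((N : ℝ) * u)) = -(u : ℂ) * G u - Pw.eval (u : ℂ) / Qw.eval (u : ℂ))
    (hper : ∀ᶠ (t : ℝ) in Filter.cofinite, k (t + 1) - k t = 0)
    (hkt : ∀ x : ℝ, ∃ g : ℝ → ℂ, AnalyticAt ℝ g x ∧ ∃ P Q : ℂ[X], Q ≠ 0 ∧
      ∀ᶠ (t : ℝ) in 𝓝[≠] x, k t = g t + P.eval (t : ℂ) / Q.eval (t : ℂ)) :
    ∀ᶠ (t : ℝ) in Filter.cofinite, k t = 0 := by
  have hN' : (0 : ℝ) < N := by exact_mod_cast hN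
  -- `G` is analytic on a ball around `0`
  obtain ⟨η, hη, hηball⟩ := Metric.eventually_nhds_iff.1 hG.eventually_analyticAt
  have hGan : ∀ v : ℝ, |v| < η → AnalyticAt ℝ G v := fun v hv => hηball (by simpa [Real.dist_eq] using hv)
  -- the dense `ℤ`-stable set `D`
  have hXfin : Set.Finite {t : ℝ | ¬ (k (t + 1) - k t = 0)} := Filter.eventually_cofinite.1 hper
  set D : Set ℝ := {t : ℝ | ∀ z : ℤ, k (t + z + 1) - k (t + z) = 0} with hD
  have hDdense : Dense D := by
    have hsub : Dᶜ ⊆ ⋃ z : ℤ, (fun t : ℝ => t - (z : ℝ)) '' {t : ℝ | ¬ (k (t + 1) - k t = 0)} := by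
      intro t ht
      simp only [hD, Set.mem_compl_iff, Set.mem_setOf_eq, not_forall] at ht
      obtain ⟨z, hz⟩ := ht
      exact Set.mem_iUnion.2 ⟨z, ⟨t + z, hz, by ring⟩⟩
    have hcount : Set.Countable Dᶜ :=
      (Set.countable_iUnion fun z => (hXfin.countable.image _)).mono hsub
    simpa using hcount.dense_compl ℝ
  have hDshift : ∀ t ∈ D, ∀ m : ℤ, t + m ∈ D := by
    intro t ht m z
    have := ht (m + z)
    push_cast at this
    simpa [add_assoc] using this
  have hkper : ∀ t ∈ D, ∀ n : ℕ, k (t + n) = k t ∧ k (t - n) = k t := by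
    intro t ht n
    induction n with
    | zero => simp
    | succ n ih =>
      constructor
      · have h1 : k (t + n + 1) - k (t + n) = 0 := by
          convert ht (n : ℤ) using 3 <;> push_cast <;> ring
        rw [sub_eq_zero] at h1
        rw [Nat.cast_succ, ← add_assoc, h1, ih.1]
      · have h1 : k (t - (n + 1 : ℕ) + 1) - k (t - (n + 1 : ℕ)) = 0 := by
          convert ht (-((n : ℤ) + 1)) using 3 <;> push_cast <;> ring
        rw [sub_eq_zero] at h1
        have h2 : t - ((n + 1 : ℕ) : ℝ) + 1 = t - n := by push_cast; ring
        rw [h2] at h1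
        rw [← h1, ih.2]
  -- thresholds for the two charts
  set δ' : ℝ := min δ η with hδ'
  have hδ'0 : 0 < δ' := lt_min hδ hη
  obtain ⟨hutR, hutL⟩ := anCore_ut_small N hN δ' hδ'0
  set TR : ℝ := 1 / δ' / N with hTR
  set TL : ℝ := (1 / δ' + 1) / N with hTL
  have hkR : ∀ t : ℝ, TR < t → Qw.eval ((((N : ℝ) * t + 1)⁻¹ : ℝ) : ℂ) ≠ 0 ∧
      k t = ((((N : ℝ) * t + 1)⁻¹ : ℝ) : ℂ) * G (((N : ℝ) * t + 1)⁻¹) +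
        Pw.eval ((((N : ℝ) * t + 1)⁻¹ : ℝ) : ℂ) / Qw.eval ((((N : ℝ) * t + 1)⁻¹ : ℝ) : ℂ) ∧
      |((N : ℝ) * t + 1)⁻¹| < η ∧ (N : ℝ) * t + 1 ≠ 0 := by
    intro t ht
    obtain ⟨hu0, huδ⟩ := hutR t ht
    have hNt : (N : ℝ) * t + 1 ≠ 0 := fun h0 => hu0.ne' (inv_eq_zero.2 h0)
    obtain ⟨hτt, -, -⟩ := anCore_ut_identities N hN t hNt
    obtain ⟨hQ, hk⟩ := hR _ hu0 (lt_of_lt_of_le huδ (min_le_left _ _))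
    rw [hτt] at hk
    exact ⟨hQ, hk, by rw [abs_of_pos hu0]; exact lt_of_lt_of_le huδ (min_le_right _ _), hNt⟩
  have hkL : ∀ t : ℝ, t < -TL → Qw.eval ((((N : ℝ) * t + 1)⁻¹ : ℝ) : ℂ) ≠ 0 ∧
      k t = -((((N : ℝ) * t + 1)⁻¹ : ℝ) : ℂ) * G (((N : ℝ) * t + 1)⁻¹) -
        Pw.eval ((((N : ℝ) * t + 1)⁻¹ : ℝ) : ℂ) / Qw.eval ((((N : ℝ) * t + 1)⁻¹ : ℝ) : ℂ) ∧
      |((N : ℝ) * t + 1)⁻¹| < η ∧ (N : ℝ) * t + 1 ≠ 0 := by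
    intro t ht
    obtain ⟨hu0, huδ⟩ := hutL t ht
    have hNt : (N : ℝ) * t + 1 ≠ 0 := fun h0 => hu0.ne (inv_eq_zero.2 h0)
    obtain ⟨hτt, -, -⟩ := anCore_ut_identities N hN t hNt
    obtain ⟨hQ, hk⟩ := hL _ hu0 (by have := min_le_left δ η; linarith)
    rw [hτt] at hk
    exact ⟨hQ, hk, by rw [abs_of_neg hu0]; have := min_le_right δ η; linarith, hNt⟩
  -- the sequences `u (t + n) → 0` and `u (t - n) → 0`
  have hseqR : ∀ t : ℝ, Tendsto (fun n : ℕ => ((N : ℝ) * (t + n) + 1)⁻¹) atTop (𝓝 0) := by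
    intro t
    have h1 : Tendsto (fun n : ℕ => (N : ℝ) * (n : ℝ) + ((N : ℝ) * t + 1)) atTop atTop :=
      tendsto_atTop_add_const_right _ _ ((tendsto_natCast_atTop_atTop).const_mul_atTop hN')
    refine (tendsto_inv_atTop_zero.comp h1).congr fun n => ?_
    simp only [Function.comp_apply]; ring_nf
  have hseqL : ∀ t : ℝ, Tendsto (fun n : ℕ => ((N : ℝ) * (t - n) + 1)⁻¹) atTop (𝓝 0) := by
    intro t
    have h1 : Tendsto (fun n : ℕ => (N : ℝ) * (n : ℝ) + (-((N : ℝ) * t + 1))) atTop atTop :=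
      tendsto_atTop_add_const_right _ _ ((tendsto_natCast_atTop_atTop).const_mul_atTop hN')
    have h2 := (tendsto_inv_atTop_zero.comp h1).neg
    rw [neg_zero] at h2
    refine h2.congr fun n => ?_
    simp only [Function.comp_apply]
    rw [← inv_neg]; congr 1; ring
  -- continuity facts
  have hPwc : ∀ v : ℝ, ContinuousAt (fun u : ℝ => Pw.eval (u : ℂ)) v :=
    fun v => (anCore_analyticAt_evalC Pw v).continuousAt
  have hQwc : ∀ v : ℝ, ContinuousAt (fun u : ℝ => Qw.eval (u : ℂ)) v :=
    fun v => (anCore_analyticAt_evalC Qw v).continuousAt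
  have hofc : ∀ v : ℝ, ContinuousAt (fun u : ℝ => (u : ℂ)) v := fun v => Complex.continuous_ofReal.continuousAt
  -- a point of `D` far to the right, and `Qw 0 ≠ 0`
  obtain ⟨t₀, ht₀D, ht₀⟩ := hDdense.exists_mem_open isOpen_Ioi ⟨TR + 1, (lt_add_one TR : TR < TR + 1)⟩
  have ht₀' : TR < t₀ := ht₀
  have hQw0 : Qw.eval ((0 : ℝ) : ℂ) ≠ 0 := by
    intro hQ0
    have hP0 : Pw.eval ((0 : ℝ) : ℂ) ≠ 0 := fun hP0 => hco _ ⟨hP0, hQ0⟩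
    -- `Pw (u_n) = (k t₀ - u_n G u_n) Qw (u_n) → (k t₀ - 0) · 0 = 0`
    have hcont : ContinuousAt (fun u : ℝ => (k t₀ - (u : ℂ) * G u) * Qw.eval (u : ℂ)) 0 :=
      (continuousAt_const.sub ((hofc 0).mul hG.continuousAt)).mul (hQwc 0)
    have h1 : Tendsto (fun n : ℕ => (k t₀ - ((((N : ℝ) * (t₀ + n) + 1)⁻¹ : ℝ) : ℂ) *
        G (((N : ℝ) * (t₀ + n) + 1)⁻¹)) * Qw.eval ((((N : ℝ) * (t₀ + n) + 1)⁻¹ : ℝ) : ℂ)) atTop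
        (𝓝 ((k t₀ - ((0 : ℝ) : ℂ) * G 0) * Qw.eval ((0 : ℝ) : ℂ))) := hcont.tendsto.comp (hseqR t₀)
    have h2 : Tendsto (fun n : ℕ => Pw.eval ((((N : ℝ) * (t₀ + n) + 1)⁻¹ : ℝ) : ℂ)) atTop
        (𝓝 (Pw.eval ((0 : ℝ) : ℂ))) := (hPwc 0).tendsto.comp (hseqR t₀)
    have heq : (fun n : ℕ => Pw.eval ((((N : ℝ) * (t₀ + n) + 1)⁻¹ : ℝ) : ℂ)) =
        (fun n : ℕ => (k t₀ - ((((N : ℝ) * (t₀ + n) + 1)⁻¹ : ℝ) : ℂ) *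
          G (((N : ℝ) * (t₀ + n) + 1)⁻¹)) * Qw.eval ((((N : ℝ) * (t₀ + n) + 1)⁻¹ : ℝ) : ℂ)) := by
      funext n
      obtain ⟨hQ, hk, -, -⟩ := hkR (t₀ + n) (by have : (0 : ℝ) ≤ n := n.cast_nonneg; linarith)
      rw [(hkper t₀ ht₀D n).1] at hk
      rw [hk, add_sub_cancel_left, div_mul_cancel₀ _ hQ]
    rw [heq] at h2
    have := tendsto_nhds_unique h2 h1
    rw [hQ0, mul_zero] at this
    exact hP0 this
  -- the right chart function is continuous at `0` with value `L`
  set L : ℂ := Pw.eval ((0 : ℝ) : ℂ) / Qw.eval ((0 : ℝ) : ℂ) with hLdef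
  have hφR : ContinuousAt (fun u : ℝ => (u : ℂ) * G u + Pw.eval (u : ℂ) / Qw.eval (u : ℂ)) 0 :=
    ((hofc 0).mul hG.continuousAt).add (anCore_analyticAt_frac Pw Qw 0 hQw0).continuousAt
  have hφL : ContinuousAt (fun u : ℝ => -(u : ℂ) * G u - Pw.eval (u : ℂ) / Qw.eval (u : ℂ)) 0 :=
    ((hofc 0).neg.mul hG.continuousAt).sub (anCore_analyticAt_frac Pw Qw 0 hQw0).continuousAt
  -- `k = L` on `D`
  have hDval : ∀ t ∈ D, k t = L := by
    have hfar : ∀ t ∈ D, TR < t → k t = L := by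
      intro t htD ht
      have h1 : Tendsto (fun n : ℕ => ((((N : ℝ) * (t + n) + 1)⁻¹ : ℝ) : ℂ) * G (((N : ℝ) * (t + n) + 1)⁻¹) +
          Pw.eval ((((N : ℝ) * (t + n) + 1)⁻¹ : ℝ) : ℂ) / Qw.eval ((((N : ℝ) * (t + n) + 1)⁻¹ : ℝ) : ℂ))
          atTop (𝓝 (((0 : ℝ) : ℂ) * G 0 + Pw.eval ((0 : ℝ) : ℂ) / Qw.eval ((0 : ℝ) : ℂ))) :=
        hφR.tendsto.comp (hseqR t)
      have heq : (fun n : ℕ => ((((N : ℝ) * (t + n) + 1)⁻¹ : ℝ) : ℂ) * G (((N : ℝ) * (t + n) + 1)⁻¹) +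
          Pw.eval ((((N : ℝ) * (t + n) + 1)⁻¹ : ℝ) : ℂ) / Qw.eval ((((N : ℝ) * (t + n) + 1)⁻¹ : ℝ) : ℂ)) =
          fun _ => k t := by
        funext n
        obtain ⟨-, hk, -, -⟩ := hkR (t + n) (by have : (0 : ℝ) ≤ n := n.cast_nonneg; linarith)
        rw [(hkper t htD n).1] at hk
        exact hk.symm
      rw [heq] at h1
      have := tendsto_const_nhds_iff.1 h1
      rw [this, hLdef]; push_cast; ring
    intro t htD
    obtain ⟨n, hn⟩ := exists_nat_gt (TR - t)
    have := hfar (t + n) (by exact_mod_cast hDshift t htD n) (by linarith)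
    rwa [(hkper t htD n).1] at this
  -- `L = 0` from the left chart
  have hL0 : L = 0 := by
    obtain ⟨t₁, ht₁D, ht₁⟩ := hDdense.exists_mem_open isOpen_Iio ⟨-TL - 1, (by
      show -TL - 1 < -TL; linarith)⟩
    have ht₁' : t₁ < -TL := ht₁
    have h1 : Tendsto (fun n : ℕ => -((((N : ℝ) * (t₁ - n) + 1)⁻¹ : ℝ) : ℂ) * G (((N : ℝ) * (t₁ - n) + 1)⁻¹) -
        Pw.eval ((((N : ℝ) * (t₁ - n) + 1)⁻¹ : ℝ) : ℂ) / Qw.eval ((((N : ℝ) * (t₁ - n) + 1)⁻¹ : ℝ) : ℂ))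
        atTop (𝓝 (-((0 : ℝ) : ℂ) * G 0 - Pw.eval ((0 : ℝ) : ℂ) / Qw.eval ((0 : ℝ) : ℂ))) :=
      hφL.tendsto.comp (hseqL t₁)
    have heq : (fun n : ℕ => -((((N : ℝ) * (t₁ - n) + 1)⁻¹ : ℝ) : ℂ) * G (((N : ℝ) * (t₁ - n) + 1)⁻¹) -
        Pw.eval ((((N : ℝ) * (t₁ - n) + 1)⁻¹ : ℝ) : ℂ) / Qw.eval ((((N : ℝ) * (t₁ - n) + 1)⁻¹ : ℝ) : ℂ)) =
        fun _ => L := by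
      funext n
      obtain ⟨-, hk, -, -⟩ := hkL (t₁ - n) (by have : (0 : ℝ) ≤ n := n.cast_nonneg; linarith)
      rw [(hkper t₁ ht₁D n).2, hDval t₁ ht₁D] at hk
      exact hk.symm
    rw [heq] at h1
    have h2 := tendsto_const_nhds_iff.1 h1
    push_cast at h2
    have h4 : (2 : ℂ) * L = 0 := by linear_combination h2
    simpa using h4
  have hD0 : ∀ t ∈ D, k t = 0 := fun t ht => by rw [hDval t ht, hL0]
  -- local vanishing on punctured neighbourhoods
  have hloc : ∀ x : ℝ, ∀ᶠ (t : ℝ) in 𝓝[≠] x, k t = (fun _ => (0 : ℂ)) t := by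
    intro x
    obtain ⟨g, hg, P, Q, hQ, hev⟩ := hkt x
    have hQev := tameDecomp_eventually_nhdsNE_of_cofinite (tameDecomp_eventually_cofinite_eval_ne_zero hQ) x
    have hgan : ∀ᶠ (t : ℝ) in 𝓝[≠] x, AnalyticAt ℝ g t := nhdsWithin_le_nhds hg.eventually_analyticAt
    obtain ⟨ε, hε, hball⟩ := Metric.eventually_nhds_iff.1
      (eventually_nhdsWithin_iff.1 ((hev.and hQev).and hgan))
    set U : Set ℝ := Metric.ball x ε \ {x} with hU
    have hUo : IsOpen U := Metric.isOpen_ball.sdiff isClosed_singleton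
    have hUmem : ∀ t ∈ U, (k t = g t + P.eval (t : ℂ) / Q.eval (t : ℂ) ∧ Q.eval (t : ℂ) ≠ 0) ∧
        AnalyticAt ℝ g t := fun t ht => hball (Metric.mem_ball.1 ht.1) ht.2
    have hz := anCore_zero_of_dense (fun t => g t + P.eval (t : ℂ) / Q.eval (t : ℂ)) U D hUo hDdense
      (fun y hy => ((hUmem y hy).2.continuousAt.add
        (anCore_analyticAt_frac P Q y (hUmem y hy).1.2).continuousAt))
      (fun t ht => by
        have := (hUmem t ht.1).1.1
        rw [← this]; exact hD0 t ht.2)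
    refine eventually_nhdsWithin_iff.2 (Metric.eventually_nhds_iff.2 ⟨ε, hε, fun t ht hne => ?_⟩)
    have htU : t ∈ U := ⟨Metric.mem_ball.2 ht, hne⟩
    rw [(hUmem t htU).1.1]; exact hz t htU
  -- the two tails
  have htail : ∀ t : ℝ, (max TR TL < t ∨ t < -max TR TL) → k t = (fun _ => (0 : ℂ)) t := by
    intro t ht
    rcases ht with ht | ht
    · -- right tail
      have hRo : IsOpen (Set.Ioi TR) := isOpen_Ioi
      have hz := anCore_zero_of_dense
        (fun s : ℝ => ((((N : ℝ) * s + 1)⁻¹ : ℝ) : ℂ) * G (((N : ℝ) * s + 1)⁻¹) +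
          Pw.eval ((((N : ℝ) * s + 1)⁻¹ : ℝ) : ℂ) / Qw.eval ((((N : ℝ) * s + 1)⁻¹ : ℝ) : ℂ))
        (Set.Ioi TR) D hRo hDdense
        (fun y hy => by
          obtain ⟨hQ, -, hηy, hNy⟩ := hkR y hy
          have hu : ContinuousAt (fun s : ℝ => ((N : ℝ) * s + 1)⁻¹) y :=
            ((continuous_const.mul continuous_id).add continuous_const).continuousAt.inv₀ hNy
          have hφ : ContinuousAt (fun u : ℝ => (u : ℂ) * G u + Pw.eval (u : ℂ) / Qw.eval (u : ℂ))
              (((N : ℝ) * y + 1)⁻¹) :=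
            ((hofc _).mul (hGan _ hηy).continuousAt).add (anCore_analyticAt_frac Pw Qw _ hQ).continuousAt
          exact ContinuousAt.comp (g := fun u : ℝ => (u : ℂ) * G u + Pw.eval (u : ℂ) / Qw.eval (u : ℂ)) hφ hu)
        (fun s hs => by
          obtain ⟨-, hk, -, -⟩ := hkR s hs.1
          rw [← hk]; exact hD0 s hs.2)
      have ht' : TR < t := lt_of_le_of_lt (le_max_left _ _) ht
      obtain ⟨-, hk, -, -⟩ := hkR t ht'
      rw [hk]; exact hz t ht'
    · -- left tail
      have hLo : IsOpen (Set.Iio (-TL)) := isOpen_Iio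
      have hz := anCore_zero_of_dense
        (fun s : ℝ => -((((N : ℝ) * s + 1)⁻¹ : ℝ) : ℂ) * G (((N : ℝ) * s + 1)⁻¹) -
          Pw.eval ((((N : ℝ) * s + 1)⁻¹ : ℝ) : ℂ) / Qw.eval ((((N : ℝ) * s + 1)⁻¹ : ℝ) : ℂ))
        (Set.Iio (-TL)) D hLo hDdense
        (fun y hy => by
          obtain ⟨hQ, -, hηy, hNy⟩ := hkL y hy
          have hu : ContinuousAt (fun s : ℝ => ((N : ℝ) * s + 1)⁻¹) y :=
            ((continuous_const.mul continuous_id).add continuous_const).continuousAt.inv₀ hNy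
          have hφ : ContinuousAt (fun u : ℝ => -(u : ℂ) * G u - Pw.eval (u : ℂ) / Qw.eval (u : ℂ))
              (((N : ℝ) * y + 1)⁻¹) :=
            ((hofc _).neg.mul (hGan _ hηy).continuousAt).sub (anCore_analyticAt_frac Pw Qw _ hQ).continuousAt
          exact ContinuousAt.comp (g := fun u : ℝ => -(u : ℂ) * G u - Pw.eval (u : ℂ) / Qw.eval (u : ℂ)) hφ hu)
        (fun s hs => by
          obtain ⟨-, hk, -, -⟩ := hkL s hs.1
          rw [← hk]; exact hD0 s hs.2)
      have ht' : t < -TL := by have := le_max_right TR TL; linarith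
      obtain ⟨-, hk, -, -⟩ := hkL t ht'
      rw [hk]; exact hz t ht'
  have := anCore_cofinite_of_local k (fun _ => (0 : ℂ)) (max TR TL) hloc (Filter.Eventually.of_forall htail)
  simpa using this

end Summit.Langlands.Langlands.Theorems
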